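import Summits.MatrixMultiplication.MatrixMultiplication.Theorems.ObstructionDescentSlotCharacterTransfer

set_option linter.dupNamespace false

/-!
# Obstruction descent, part AB — SLOT CHARACTERS FORM A CHARACTER OF `S₃`: multiplicativity, conjugation invariance,
# commutators act trivially; on a level LINE all transpositions share one sign and the 3-cycles act trivially; transfer

`route-MatrixMultiplication-ObstructionDescent`, aside `InvariantSaturation` (stmt 32282); decomp-mm lens-3, NODE-g16.  Parts Y/Z/AA
use slot characters `f^σ = χ_σ·f` one permutation at a time.  Here the elementary group theory, with no enumeration of `S₃`
beyond three identities checked by `decide`: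

* §1 `slotChar_mul`, `slotChar_ne_zero`, `slotChar_inv`, `slotChar_conj` (a simultaneous eigenvector has the SAME character under
  conjugate permutations), `rename_commutator_eq_self` (commutators act trivially on simultaneous eigenvectors);
* §2 in `S₃`: the transpositions are pairwise conjugate and both 3-cycles are commutators of transpositions (`decide`), hence
  on a simultaneous eigenvector `f ≠ 0` of the slot action ALL THREE TRANSPOSITIONS ACT BY ONE SIGN `ε = ±1`
  (`slotChar_swap_zero_two_eq`, `slotChar_swap_one_two_eq`) and BOTH 3-CYCLES ACT TRIVIALLY (`rename_cycle_eq_self`,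
  `rename_cycle'_eq_self`) — so the census's single sign `χ_F(N)` per format (I45) is the complete `S₃`-datum of a level line;
* §3 lines: on an `S₃`-stable line `ℂ·G` (every level space of dimension `1`, part Y) the character of `G` is uniform
  (`slotChar_uniform_of_line`);
* §4 TRANSFER (part AA) consequences for the next format: if the corner space `R_k(m')` is a line `ℂ·G`, `G ≠ 0`, then every
  level-`k` function of format `m' + 1` is invariant under CYCLIC ROTATION OF THE THREE SLOTS on tensors of rank `≤ r`,
  `(k−1)r < k(m'+1)` (`evalT_permT_cycle_eq`), and transforms under every transposition by the one sign `ε` of `G`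
  (`evalT_permT_swap_eq_sign_mul`).  (Cyclic slot symmetry is the symmetry of the matrix multiplication tensors `⟨n,n,n⟩`;
  at level `3` the hypothesis «`R₃(m')` is a line» holds for `m' = 3, 4, 5, 6, 8, 9` by the census, I42/I45.)

[cite: BurgisserIkenmeyer2011, §3.1–3.2, §6.2], [cite: BurgisserIkenmeyer2017, §5], [cite: LandsbergGCT2017, §2.1, §8.3].
-/

noncomputable section

open scoped BigOperators
open Finset

namespace Summit.MatrixMultiplication.MatrixMultiplication.Theorems.ObstructionCalculus

open Literature.Computability.AlgebraicComplexity (tensorRank)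

variable {m : ℕ}

/-! ### §1 Characters multiply -/

section Group

variable {f : MvPolynomial (Idx m) ℂ}

/-- **Slot characters multiply:** `f^σ = a f`, `f^τ = b f ⇒ f^{τσ} = (b a) f` (the pull-back composes contravariantly,
`rename_slotPerm_rename_slotPerm`). [this node] -/
theorem slotChar_mul {σ τ : Equiv.Perm (Fin 3)} {a b : ℂ} (hσ : MvPolynomial.rename (slotPerm σ) f = a • f)
    (hτ : MvPolynomial.rename (slotPerm τ) f = b • f) : MvPolynomial.rename (slotPerm (τ * σ)) f = (b * a) • f := by
  rw [← rename_slotPerm_rename_slotPerm, hτ, map_smul, hσ, smul_smul]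

/-- A character of a nonzero eigenvector is nonzero. [bookkeeping] -/
theorem slotChar_ne_zero {σ : Equiv.Perm (Fin 3)} {a : ℂ} (hσ : MvPolynomial.rename (slotPerm σ) f = a • f) (hf0 : f ≠ 0) :
    a ≠ 0 := by
  rintro rfl
  have h := congrArg (MvPolynomial.rename (slotPerm σ⁻¹)) hσ
  rw [rename_slotPerm_inv_rename, zero_smul, map_zero] at h
  exact hf0 h

/-- The inverse permutation acts by the inverse character. [this node] -/
theorem slotChar_inv {σ : Equiv.Perm (Fin 3)} {a : ℂ} (hσ : MvPolynomial.rename (slotPerm σ) f = a • f) (hf0 : f ≠ 0) :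
    MvPolynomial.rename (slotPerm σ⁻¹) f = a⁻¹ • f := by
  have ha := slotChar_ne_zero hσ hf0
  have h := congrArg (MvPolynomial.rename (slotPerm σ⁻¹)) hσ
  rw [rename_slotPerm_inv_rename, map_smul] at h
  calc MvPolynomial.rename (slotPerm σ⁻¹) f = a⁻¹ • a • MvPolynomial.rename (slotPerm σ⁻¹) f := by
        rw [smul_smul, inv_mul_cancel₀ ha, one_smul]
    _ = a⁻¹ • f := by rw [← h]

/-- **Conjugate permutations have the same character** on a simultaneous eigenvector. [this node] -/
theorem slotChar_conj {σ g : Equiv.Perm (Fin 3)} {a c : ℂ} (hσ : MvPolynomial.rename (slotPerm σ) f = a • f)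
    (hg : MvPolynomial.rename (slotPerm g) f = c • f) (hf0 : f ≠ 0) :
    MvPolynomial.rename (slotPerm (g * σ * g⁻¹)) f = a • f := by
  have hc := slotChar_ne_zero hg hf0
  have h1 : MvPolynomial.rename (slotPerm (g * σ)) f = (c * a) • f := slotChar_mul hσ hg
  have h2 := slotChar_mul (slotChar_inv hg hf0) h1
  rw [h2, mul_comm c a, mul_inv_cancel_right₀ hc]

/-- **Commutators act trivially** on a simultaneous eigenvector. [this node] -/
theorem rename_commutator_eq_self {σ τ : Equiv.Perm (Fin 3)} {a b : ℂ} (hσ : MvPolynomial.rename (slotPerm σ) f = a • f)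
    (hτ : MvPolynomial.rename (slotPerm τ) f = b • f) (hf0 : f ≠ 0) :
    MvPolynomial.rename (slotPerm (σ * τ * σ⁻¹ * τ⁻¹)) f = f := by
  have hb := slotChar_ne_zero hτ hf0
  have h1 : MvPolynomial.rename (slotPerm (σ * τ * σ⁻¹)) f = b • f := slotChar_conj hτ hσ hf0
  have h2 := slotChar_mul (slotChar_inv hτ hf0) h1
  rwa [mul_inv_cancel₀ hb, one_smul] at h2

end Group

/-! ### §2 The group `S₃`: one sign, trivial 3-cycles -/

section SymmetricThree

/-- The transposition `(0 2)` is conjugate to `(0 1)` by `(1 2)`. [bookkeeping] -/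
theorem swap_zero_two_eq_conj :
    (Equiv.swap (0 : Fin 3) 2 : Equiv.Perm (Fin 3)) = Equiv.swap 1 2 * Equiv.swap 0 1 * (Equiv.swap 1 2)⁻¹ := by decide

/-- The transposition `(1 2)` is conjugate to `(0 2)` by `(0 1)`. [bookkeeping] -/
theorem swap_one_two_eq_conj :
    (Equiv.swap (1 : Fin 3) 2 : Equiv.Perm (Fin 3)) = Equiv.swap 0 1 * Equiv.swap 0 2 * (Equiv.swap 0 1)⁻¹ := by decide

/-- The 3-cycle `(0 1)(1 2)` is a commutator of transpositions. [bookkeeping] -/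
theorem cycle_eq_commutator : (Equiv.swap (0 : Fin 3) 1 * Equiv.swap 1 2 : Equiv.Perm (Fin 3)) =
    Equiv.swap 1 2 * Equiv.swap 0 1 * (Equiv.swap 1 2)⁻¹ * (Equiv.swap 0 1)⁻¹ := by decide

/-- The other 3-cycle `(1 2)(0 1)` is a commutator of transpositions. [bookkeeping] -/
theorem cycle'_eq_commutator : (Equiv.swap (1 : Fin 3) 2 * Equiv.swap 0 1 : Equiv.Perm (Fin 3)) =
    Equiv.swap 0 1 * Equiv.swap 1 2 * (Equiv.swap 0 1)⁻¹ * (Equiv.swap 1 2)⁻¹ := by decide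

/-- `S₃` has exactly the three transpositions `(0 1)`, `(0 2)`, `(1 2)`. [bookkeeping] -/
theorem swap_cases : ∀ i j : Fin 3, i ≠ j →
    Equiv.swap i j = Equiv.swap 0 1 ∨ Equiv.swap i j = Equiv.swap 0 2 ∨ Equiv.swap i j = Equiv.swap 1 2 := by decide

variable {f : MvPolynomial (Idx m) ℂ}

/-- **One sign for all transpositions (i):** a simultaneous eigenvector of `(0 1)` and `(1 2)` has under `(0 2)` the character of
`(0 1)`. [this node] -/
theorem slotChar_swap_zero_two_eq {a c : ℂ} (h01 : MvPolynomial.rename (slotPerm (Equiv.swap 0 1)) f = a • f)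
    (h12 : MvPolynomial.rename (slotPerm (Equiv.swap 1 2)) f = c • f) (hf0 : f ≠ 0) :
    MvPolynomial.rename (slotPerm (Equiv.swap 0 2)) f = a • f := by
  rw [swap_zero_two_eq_conj]; exact slotChar_conj h01 h12 hf0

/-- **One sign for all transpositions (ii):** … and under `(1 2)` the character of `(0 2)`; so all three agree. [this node] -/
theorem slotChar_swap_one_two_eq {a b : ℂ} (h02 : MvPolynomial.rename (slotPerm (Equiv.swap 0 2)) f = a • f)
    (h01 : MvPolynomial.rename (slotPerm (Equiv.swap 0 1)) f = b • f) (hf0 : f ≠ 0) :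
    MvPolynomial.rename (slotPerm (Equiv.swap 1 2)) f = a • f := by
  rw [swap_one_two_eq_conj]; exact slotChar_conj h02 h01 hf0

/-- All three transpositions act by the character of `(0 1)` on a simultaneous eigenvector of `(0 1)` and `(1 2)`. [this node] -/
theorem slotChar_swap_eq {a c : ℂ} (h01 : MvPolynomial.rename (slotPerm (Equiv.swap 0 1)) f = a • f)
    (h12 : MvPolynomial.rename (slotPerm (Equiv.swap 1 2)) f = c • f) (hf0 : f ≠ 0) :
    MvPolynomial.rename (slotPerm (Equiv.swap 0 2)) f = a • f ∧ MvPolynomial.rename (slotPerm (Equiv.swap 1 2)) f = a • f := by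
  have h02 := slotChar_swap_zero_two_eq h01 h12 hf0
  exact ⟨h02, slotChar_swap_one_two_eq h02 h01 hf0⟩

/-- **3-cycles act trivially (i)** on a simultaneous eigenvector of the transpositions `(0 1)`, `(1 2)`. [this node] -/
theorem rename_cycle_eq_self {a c : ℂ} (h01 : MvPolynomial.rename (slotPerm (Equiv.swap 0 1)) f = a • f)
    (h12 : MvPolynomial.rename (slotPerm (Equiv.swap 1 2)) f = c • f) (hf0 : f ≠ 0) :
    MvPolynomial.rename (slotPerm (Equiv.swap 0 1 * Equiv.swap 1 2)) f = f := by
  rw [cycle_eq_commutator]; exact rename_commutator_eq_self h12 h01 hf0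

/-- **3-cycles act trivially (ii).** [this node] -/
theorem rename_cycle'_eq_self {a c : ℂ} (h01 : MvPolynomial.rename (slotPerm (Equiv.swap 0 1)) f = a • f)
    (h12 : MvPolynomial.rename (slotPerm (Equiv.swap 1 2)) f = c • f) (hf0 : f ≠ 0) :
    MvPolynomial.rename (slotPerm (Equiv.swap 1 2 * Equiv.swap 0 1)) f = f := by
  rw [cycle'_eq_commutator]; exact rename_commutator_eq_self h01 h12 hf0

/-- The common sign is `±1`. [bookkeeping] -/
theorem slotChar_swap_sq_eq_one {a : ℂ} (h01 : MvPolynomial.rename (slotPerm (Equiv.swap 0 1)) f = a • f) (hf0 : f ≠ 0) :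
    a = 1 ∨ a = -1 :=
  slotChar_eq_one_or_neg_one (Equiv.swap_mul_self 0 1) h01 hf0

end SymmetricThree

/-! ### §3 Lines -/

/-- On a line `ℂ·G`, the character of the generator is the character of every vector. [bookkeeping] -/
theorem slotChar_uniform_of_line (σ : Equiv.Perm (Fin 3)) {V : Submodule ℂ (MvPolynomial (Idx m) ℂ)}
    {G : MvPolynomial (Idx m) ℂ} (hV : ∀ g ∈ V, ∃ c : ℂ, g = c • G) {a : ℂ}
    (hG : MvPolynomial.rename (slotPerm σ) G = a • G) : ∀ g ∈ V, MvPolynomial.rename (slotPerm σ) g = a • g := by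
  intro g hg
  obtain ⟨c, rfl⟩ := hV g hg
  rw [map_smul, hG, smul_comm]

/-- **The `S₃`-datum of a level line is one sign.**  If a level space `R = hwvSpace (rectType m N k) (k N)` is a line `ℂ·G`,
`G ∈ R`, `G ≠ 0`, then there is `ε = ±1` with: every transposition acts on `R` by `ε` and both 3-cycles act trivially.
[this node] -/
theorem exists_sign_of_level_line {N k : ℕ} {G : MvPolynomial (Idx m) ℂ} (hGm : G ∈ hwvSpace (rectType m N k) (k * N))
    (hG0 : G ≠ 0) (hV : ∀ g ∈ hwvSpace (rectType m N k) (k * N), ∃ c : ℂ, g = c • G) :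
    ∃ ε : ℂ, (ε = 1 ∨ ε = -1) ∧
      (∀ g ∈ hwvSpace (rectType m N k) (k * N), MvPolynomial.rename (slotPerm (Equiv.swap 0 1)) g = ε • g) ∧
      (∀ g ∈ hwvSpace (rectType m N k) (k * N), MvPolynomial.rename (slotPerm (Equiv.swap 0 2)) g = ε • g) ∧
      (∀ g ∈ hwvSpace (rectType m N k) (k * N), MvPolynomial.rename (slotPerm (Equiv.swap 1 2)) g = ε • g) ∧
      (∀ g ∈ hwvSpace (rectType m N k) (k * N),
        MvPolynomial.rename (slotPerm (Equiv.swap 0 1 * Equiv.swap 1 2)) g = g) ∧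
      (∀ g ∈ hwvSpace (rectType m N k) (k * N),
        MvPolynomial.rename (slotPerm (Equiv.swap 1 2 * Equiv.swap 0 1)) g = g) := by
  obtain ⟨ε, h01⟩ := exists_slotChar_level (Equiv.swap 0 1) hV hGm
  obtain ⟨c, h12⟩ := exists_slotChar_level (Equiv.swap 1 2) hV hGm
  obtain ⟨h02, h12'⟩ := slotChar_swap_eq h01 h12 hG0
  refine ⟨ε, slotChar_swap_sq_eq_one h01 hG0, slotChar_uniform_of_line _ hV h01, slotChar_uniform_of_line _ hV h02,
    slotChar_uniform_of_line _ hV h12', fun g hg => ?_, fun g hg => ?_⟩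
  · have h := slotChar_uniform_of_line (Equiv.swap 0 1 * Equiv.swap 1 2) hV (a := 1)
      (by rw [one_smul]; exact rename_cycle_eq_self h01 h12 hG0) g hg
    rwa [one_smul] at h
  · have h := slotChar_uniform_of_line (Equiv.swap 1 2 * Equiv.swap 0 1) hV (a := 1)
      (by rw [one_smul]; exact rename_cycle'_eq_self h01 h12 hG0) g hg
    rwa [one_smul] at h

/-! ### §4 Transfer to the next format -/

section Transfer

variable {m' : ℕ}

/-- **Cyclic slot symmetry on low rank.**  If the corner level space `R_k(m')` (in format `m' + 1`) is a line `ℂ·G`, `G ≠ 0`,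
then EVERY level-`k` vector `f` of format `m' + 1` is invariant under the cyclic rotation of the three slots on tensors of rank
`≤ r`, `(k−1)r < k(m'+1)`. [this node] -/
theorem evalT_permT_cycle_eq {k : ℕ} {G : MvPolynomial (Idx (m' + 1)) ℂ}
    (hGm : G ∈ hwvSpace (rectType (m' + 1) m' k) (k * m')) (hG0 : G ≠ 0)
    (hV : ∀ g ∈ hwvSpace (rectType (m' + 1) m' k) (k * m'), ∃ c : ℂ, g = c • G)
    {f : MvPolynomial (Idx (m' + 1)) ℂ} (hf : f ∈ hwvSpace (rectType (m' + 1) (m' + 1) k) (k * (m' + 1)))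
    {r : ℕ} (hr : (k - 1) * r < k * (m' + 1)) {t : Tensor ℂ (m' + 1)} (ht : tensorRank t ≤ r) :
    evalT (permT (Equiv.swap 0 1 * Equiv.swap 1 2) t) f = evalT t f ∧
      evalT (permT (Equiv.swap 1 2 * Equiv.swap 0 1) t) f = evalT t f := by
  obtain ⟨ε, -, -, -, -, hc, hc'⟩ := exists_sign_of_level_line hGm hG0 hV
  exact ⟨evalT_permT_eq_of_slotChar_one _ hc hf hr ht, evalT_permT_eq_of_slotChar_one _ hc' hf hr ht⟩

/-- **One sign for all transpositions on low rank.**  Under the same hypothesis, with `ε = ±1` the sign of the line `ℂ·G`: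
`f(τ·t) = ε·f(t)` for every transposition `τ`, every `f ∈ R_k(m'+1)`, `R(t) ≤ r`, `(k−1)r < k(m'+1)`. [this node] -/
theorem evalT_permT_swap_eq_sign_mul {k : ℕ} {G : MvPolynomial (Idx (m' + 1)) ℂ}
    (hGm : G ∈ hwvSpace (rectType (m' + 1) m' k) (k * m')) (hG0 : G ≠ 0)
    (hV : ∀ g ∈ hwvSpace (rectType (m' + 1) m' k) (k * m'), ∃ c : ℂ, g = c • G)
    {f : MvPolynomial (Idx (m' + 1)) ℂ} (hf : f ∈ hwvSpace (rectType (m' + 1) (m' + 1) k) (k * (m' + 1)))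
    {r : ℕ} (hr : (k - 1) * r < k * (m' + 1)) :
    ∃ ε : ℂ, (ε = 1 ∨ ε = -1) ∧ ∀ t : Tensor ℂ (m' + 1), tensorRank t ≤ r →
      evalT (permT (Equiv.swap 0 1) t) f = ε * evalT t f ∧ evalT (permT (Equiv.swap 0 2) t) f = ε * evalT t f ∧
        evalT (permT (Equiv.swap 1 2) t) f = ε * evalT t f := by
  obtain ⟨ε, hε, h01, h02, h12, -, -⟩ := exists_sign_of_level_line hGm hG0 hV
  exact ⟨ε, hε, fun t ht => ⟨evalT_permT_eq_slotChar_mul _ h01 hf hr ht, evalT_permT_eq_slotChar_mul _ h02 hf hr ht,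
    evalT_permT_eq_slotChar_mul _ h12 hf hr ht⟩⟩

/-- **Odd line ⇒ vanishing at transposition-symmetric points:** if the sign of the corner line `ℂ·G` is `−1` (i.e. some — hence
every — transposition acts by `−1` on `G`), every level-`k` vector of format `m' + 1` vanishes at every tensor of rank `≤ r`
fixed by SOME transposition, `(k−1)r < k(m'+1)`; in particular at the unit tensor `⟨m'+1⟩` (`k ≥ 1`). [this node] -/
theorem evalT_eq_zero_of_odd_line_of_swap_fixed {k : ℕ} {G : MvPolynomial (Idx (m' + 1)) ℂ}
    (hGm : G ∈ hwvSpace (rectType (m' + 1) m' k) (k * m')) (hG0 : G ≠ 0)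
    (hV : ∀ g ∈ hwvSpace (rectType (m' + 1) m' k) (k * m'), ∃ c : ℂ, g = c • G)
    (hodd : MvPolynomial.rename (slotPerm (Equiv.swap 0 1)) G = (-1 : ℂ) • G)
    {f : MvPolynomial (Idx (m' + 1)) ℂ} (hf : f ∈ hwvSpace (rectType (m' + 1) (m' + 1) k) (k * (m' + 1)))
    {r : ℕ} (hr : (k - 1) * r < k * (m' + 1)) {t : Tensor ℂ (m' + 1)} (ht : tensorRank t ≤ r) {i j : Fin 3} (hij : i ≠ j)
    (hsym : permT (Equiv.swap i j) t = t) : evalT t f = 0 := by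
  obtain ⟨c, h12⟩ := exists_slotChar_level (Equiv.swap 1 2) hV hGm
  obtain ⟨h02, h12'⟩ := slotChar_swap_eq hodd h12 hG0
  have hne : (-1 : ℂ) ≠ 1 := by norm_num
  have key : ∀ τ : Equiv.Perm (Fin 3), MvPolynomial.rename (slotPerm τ) G = (-1 : ℂ) • G → permT τ t = t → evalT t f = 0 :=
    fun τ hτ hτt => evalT_eq_zero_of_permT_eq_self τ hne (slotChar_uniform_of_line τ hV hτ) hf hr ht hτt
  -- the transposition `swap i j` is one of the three
  rcases swap_cases i j hij with h | h | h
  · exact key _ hodd (h ▸ hsym)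
  · exact key _ h02 (h ▸ hsym)
  · exact key _ h12' (h ▸ hsym)

end Transfer

end Summit.MatrixMultiplication.MatrixMultiplication.Theorems.ObstructionCalculus
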